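import Mathlib
import Literature.NumberTheory.LFunctions.Zhang2022.Section7MeanSquareMajorant
import Literature.NumberTheory.LFunctions.MertensFormula
import Literature.Analysis.SpecialFunctions.GammaVerticalRatio

/-!
# Zhang (2022) §7, (7.5): the exponent `9` is attained — a lower bound of order `(log X)^9` on the class (7.2)

Trunk T-ANT (NumberTheory/LFunctions). Y. Zhang, *Discrete mean estimates and the Landau–Siegel
zero*, arXiv:2211.02515v1 (2022) [Zhang2022LandauSiegel], §7 (7.5) [p. 13 of the source], with
(7.2) [p. 13], (2.10) [p. 4] and (2.13) [p. 5]. **Status of the source: an unrefereed manuscript, a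
claimed result under adjudication** (cell pub-zhang: audit + repair census of arXiv:2211.02515; no
claim about Landau–Siegel). Companion of `Zhang2022.Section7MeanSquareMajorant` (cell ALT seat 3,
`HOME/ALT-3.md` §B3, §L2), which proves the UPPER bound
`∑_{m≤X} |(κ∗a)(m)|²/m ≤ ‖a‖_∞² · O_L(1) · (log X)^9` for Zhang's
`κ = n^{-β₁} ∗ n^{-β₂} ∗ n^{-β₃} ∗ μ` (`β_j = i b_j` purely imaginary, (2.13)) and every bounded
sequence `a` (the class (7.2): `a₁(n) ≪ 1`). This file proves the matching LOWER bound on the same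
class, recorded in `HOME/ALT-3.md` §L2 as "B14 … NOT formalised": for the bounded sequence `a ≡ 1`,

  `∑_{m≤X} |(κ∗1)(m)|²/m ≥ c(L) · (log X)^9`,  `c(L) = e^{-(297+18L)}/(2·80⁹)`,

whenever `log X ≥ 80` and `(|b₁|+|b₂|+|b₃|) log X ≤ L` (`sum_norm_kappa_conv_one_sq_div_ge_of_le_log`;
the two-scale form `sum_norm_kappa_conv_one_sq_div_ge` has `c = e^{-(297+18L)}/2` in `(log y)^9` for
any `y ≥ 2` with `18(log y + 2) ≤ log X`). Together with the companion's upper bound this is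
`sum_norm_kappa_conv_sq_div_two_sided`: on the class (7.2) the exponent of `log X` in the
mean-square input (7.5) is EXACTLY `9` — a majorant of the shape `‖a‖_∞² · (log X)^k` holds for all
bounded `a` with `k = 9` and with no `k < 9`. In the cell's bookkeeping (MV-E, `ExponentLayerMV`,
`PartIFloorK9`): the value `k5mv = 9` read at (7.5) is two-sided on (7.2), so any further saving at
this step must use structure of `a₁` beyond boundedness. Nothing about the manuscript's theorems is
asserted; the source is quoted in the companion's docstring.

## The argument (elementary; all inputs are in the tree or Mathlib)

Write `F = κ ∗ 𝟙 = n^{-β₁} ∗ n^{-β₂} ∗ n^{-β₃}` (`μ ∗ 𝟙 = δ`, Mathlib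
`ArithmeticFunction.coe_moebius_mul_coe_zeta`), a multiplicative function with
`F(p) = p^{-ib₁} + p^{-ib₂} + p^{-ib₃}`, so `|F(p)|² ≤ 9` and, since `|p^{-ib} − 1| ≤ |b| log p`
(`norm_powI_sub_one_le`), `|F(p)| ≥ 3 − B log p` and `|F(p)|² ≥ 9 − 6B log p`, `B = ∑|b_j|`.
For a multiplicative `F` with `a − K log p ≤ |F(p)|² ≤ A` at primes (`sum_norm_sq_div_ge`):

1. restrict `∑_{m≤Y} |F(m)|²/m` to squarefree `m = ∏S`, `S ⊆ {p ≤ y}`, `∏S ≤ Y`, where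
   `|F(∏S)|²/∏S = ∏_{p∈S} |F(p)|²/p` (`sum_powerset_filter_le_sum_Icc`; `S ↦ ∏S` is injective on
   sets of primes, Mathlib `Nat.primeFactors_prod`);
2. the full sum over `S ⊆ {p ≤ y}` is `M = ∏_{p≤y} (1 + |F(p)|²/p)` (Mathlib `Finset.prod_one_add`)
   and `log M ≥ ∑ (u_p − u_p²)`, `u_p = |F(p)|²/p` (the tree's `GammaRatio.sub_sq_le_log_one_add`,
   `log(1+u) ≥ u − u²`), so by Mertens II FROM
   BELOW (`loglog_sub_le_sum_inv_primesLE`: `∑_{p≤y} 1/p ≥ log log y − 24`, from the tree's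
   `Mertens.abs_primeRecipSum_sub_le` [HardyWright2008, Thm 427 with rate] and the crude
   `B₁ ≥ −12`, `neg_twelve_le_meisselMertens`), Mertens I from above
   (`MertensBound.sum_log_div_prime_le`) and `∑ 1/(p(p−1)) ≤ 1`
   (`MertensBound.sum_inv_prime_mul_pred_le_one`):  `M ≥ e^{−(24a + A² + 3L)} (log y)^a` when
   `K log y ≤ L` (`exp_mul_log_pow_le_prod`);
3. the tail `∏S > Y` is at most `[A(log y + log 4)/log Y] · M ≤ M/2` by the logarithmic weighting
   `1 ≤ log(∏S)/log Y`, the weighted powerset inequality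
   `∑_S (∏_S u)(∑_S log p) ≤ (∑_p u_p log p) ∏_p (1 + u_p)` (`sum_powerset_prod_mul_sum_le`) and
   Mertens I (`sum_powerset_filter_prod_div_le`, `prod_le_two_mul_sum_powerset_filter`), provided
   `2A(log y + 2) ≤ log Y`.

With `a = A = 9`, `K = 6B` this gives the two-scale form; `y = ⌊X^{1/40}⌋` gives the form in `X`
alone. Numbers, not adjectives: the constants (`24`, `e^{-297}`, `80⁹`, the threshold `log X ≥ 80`)
are crude and not optimised; only the exponent `9` and the dependence on `L` through a factor
`e^{-18L}` (against `e^{32L}` above) are asserted. In the source's normalisation `X = P²`,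
`∑|b_j| ≤ 6α(1 + 5c′α𝓛)` by (2.13) and `α log P² = 2π` by (2.10), so `L = 12π(1 + 5c′α𝓛)` as in
the companion.

Scope (deliberately NOT here): the sequence `a₁` of the source is supported on `n ∼ N` inside a
longer Dirichlet polynomial; the class on which the companion's majorant is proved, and on which the
cell's exponent `k5mv` is read, is "all `a` with `‖a‖_∞ ≤ C`" [(7.2)], and that is the class decided
here. The large-sieve/Hölder step of (7.5), Proposition 2.1, (14.3)/(15.5) and every other row of
the cell are untouched; no statement about Theorems 1–2 of the source is made or implied, and the
cell's census (R8) is unchanged by this file.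

## References

* [Zhang2022LandauSiegel] Y. Zhang, arXiv:2211.02515v1, §7 (7.2), (7.5) p. 13; (2.10) p. 4; (2.13) p. 5.
* [HardyWright2008] G. H. Hardy, E. M. Wright, *An Introduction to the Theory of Numbers*, 6th ed.,
  OUP 2008, Thm 425 (§22.6), Thm 427 (§22.7, Mertens' second theorem), §22.8.

## Mathlib / tree

Used: `Finset.prod_one_add`, `Finset.sum_powerset_insert`, `Finset.sum_filter_add_sum_filter_not`,
`Finset.sum_image`, `Nat.primeFactors_prod`, `ArithmeticFunction.IsMultiplicative.map_prod_of_prime`,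
`ArithmeticFunction.coe_moebius_mul_coe_zeta`, `ArithmeticFunction.coe_mul_zeta_apply`,
`Real.exp_nat_mul`, `Real.log_two_gt_d9`/`lt_d9`; tree:
`Literature.Analysis.SpecialFunctions.GammaRatio.sub_sq_le_log_one_add` (`GammaVerticalRatio`),
`Mertens.abs_primeRecipSum_sub_le`, `Mertens.primeRecipSum`, `Mertens.meisselMertens`
(`MertensFormula`, `MertensConstant`), `MertensBound.sum_log_div_prime_le`,
`MertensBound.sum_inv_prime_mul_pred_le_one` (`MertensElementary`), and from the companion
`conv`, `powI`, `kappa`, `mul_apply_prime`, `norm_powI_of_pos`, `norm_powI_sub_one_le`,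
`majorantConst`, `sum_norm_kappa_conv_sq_div_le_of_mul_log_le`.
-/

noncomputable section

open Finset Real ArithmeticFunction

namespace Literature.NumberTheory.LFunctions.Zhang2022.MeanSquareMajorant

/-! ### Part 1. Mertens' second theorem from below, crude explicit form -/

/-- `B₁ ≥ −12` for the Meissel–Mertens constant (`B₁ = 0.2614…`; crude): the tree's
`|∑_{p≤x} 1/p − log log x − B₁| ≤ 8/log x` at `x = 2`, with `∑_{p≤2} 1/p ≥ 0`, `log log 2 ≤ 0` and
`8/log 2 ≤ 12`. [cite: HardyWright2008, Thm 427 (§22.7)] -/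
theorem neg_twelve_le_meisselMertens : -12 ≤ Mertens.meisselMertens := by
  have h := Mertens.abs_primeRecipSum_sub_le (x := 2) le_rfl
  have h0 : 0 ≤ Mertens.primeRecipSum 2 := by
    unfold Mertens.primeRecipSum
    exact sum_nonneg fun p _ => inv_nonneg.2 (Nat.cast_nonneg p)
  have hlog2 := Real.log_two_gt_d9
  have hlog2' := Real.log_two_lt_d9
  have hll : Real.log (Real.log 2) ≤ 0 := Real.log_nonpos (by linarith) (by linarith)
  have h8 : 8 / Real.log 2 ≤ 12 := by
    rw [div_le_iff₀ (by linarith)]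
    linarith
  have h' := (abs_le.1 h).2
  linarith

/-- **Mertens' second theorem from below, explicit** (Hardy–Wright Thm 427:
`∑_{p≤x} 1/p = log log x + B₁ + O(1/log x)`): for `y ≥ 2`, `∑_{p ≤ y} 1/p ≥ log log y − 24`
(`B₁ ≥ −12` and `8/log y ≤ 12`). [cite: HardyWright2008, Thm 427 (§22.7)] -/
theorem loglog_sub_le_sum_inv_primesLE {y : ℕ} (hy : 2 ≤ y) :
    Real.log (Real.log y) - 24 ≤ ∑ p ∈ Nat.primesLE y, (p : ℝ)⁻¹ := by
  have hy' : (2 : ℝ) ≤ y := by exact_mod_cast hy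
  have h := Mertens.abs_primeRecipSum_sub_le hy'
  have hP : Mertens.primeRecipSum y = ∑ p ∈ Nat.primesLE y, (p : ℝ)⁻¹ := by
    unfold Mertens.primeRecipSum
    rw [Nat.floor_natCast]
  have hlog2 := Real.log_two_gt_d9
  have hlogy : Real.log 2 ≤ Real.log y := Real.log_le_log two_pos hy'
  have h8 : 8 / Real.log y ≤ 12 := by
    rw [div_le_iff₀ (by linarith)]
    nlinarith
  have hB := neg_twelve_le_meisselMertens
  have h' := (abs_le.1 h).1
  rw [hP] at h'
  linarith

/-! ### Part 2. The squarefree-support engine -/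

/-- **The Euler-type product from below.** If `0 ≤ f(p) ≤ A` and `f(p) ≥ a − K log p` at primes
(`a : ℕ`, `K ≥ 0`), then for `y ≥ 2` with `K log y ≤ L`:
`∏_{p ≤ y} (1 + f(p)/p) ≥ exp(−(24a + A² + 3L)) · (log y)^a`
(`log(1+u) ≥ u − u²` from the tree, Mertens II from below, Mertens I from above,
`∑_p 1/(p(p−1)) ≤ 1`, `log 4 ≤ 2 log y`). [folklore] -/
theorem exp_mul_log_pow_le_prod {f : ℕ → ℝ} {a : ℕ} {A K L : ℝ} (hK : 0 ≤ K)
    (hf0 : ∀ p : ℕ, p.Prime → 0 ≤ f p) (hfA : ∀ p : ℕ, p.Prime → f p ≤ A)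
    (hfa : ∀ p : ℕ, p.Prime → (a : ℝ) - K * Real.log p ≤ f p) {y : ℕ} (hy : 2 ≤ y)
    (hL : K * Real.log y ≤ L) :
    Real.exp (-(24 * a + A ^ 2 + 3 * L)) * Real.log y ^ a ≤
      ∏ p ∈ Nat.primesLE y, (1 + f p / p) := by
  set T := Nat.primesLE y with hT
  have hmem : ∀ p ∈ T, p.Prime := fun p hp => (Nat.mem_primesLE.1 hp).2
  have hy' : (2 : ℝ) ≤ y := by exact_mod_cast hy
  have hlogy : 0 < Real.log y := Real.log_pos (by linarith)
  have ha0 : (0 : ℝ) ≤ a := Nat.cast_nonneg a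
  have hA : 0 ≤ A := (hf0 2 Nat.prime_two).trans (hfA 2 Nat.prime_two)
  have hw0 : ∀ p ∈ T, 0 ≤ f p / p := fun p hp =>
    div_nonneg (hf0 p (hmem p hp)) (Nat.cast_nonneg p)
  have hpos : ∀ p ∈ T, 0 < 1 + f p / p := fun p hp => by linarith [hw0 p hp]
  have hprodpos : 0 < ∏ p ∈ T, (1 + f p / p) := prod_pos hpos
  -- (1) the logarithm of the product
  have hlog : ∑ p ∈ T, (f p / p - (f p / p) ^ 2) ≤ Real.log (∏ p ∈ T, (1 + f p / p)) := by
    rw [Real.log_prod (fun p hp => (hpos p hp).ne')]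
    exact sum_le_sum fun p hp =>
      Literature.Analysis.SpecialFunctions.GammaRatio.sub_sq_le_log_one_add (hw0 p hp)
  -- (2) the squares: `∑ (f p/p)² ≤ A² ∑ 1/(p(p-1)) ≤ A²`
  have hsq : ∑ p ∈ T, (f p / p) ^ 2 ≤ A ^ 2 := by
    calc ∑ p ∈ T, (f p / p) ^ 2 ≤ ∑ p ∈ T, A ^ 2 * (1 / ((p : ℝ) * (p - 1))) :=
          sum_le_sum fun p hp => by
            have hpp := hmem p hp
            have hp2 : (2 : ℝ) ≤ p := by exact_mod_cast hpp.two_le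
            have hp1 : (0 : ℝ) < (p : ℝ) * (p - 1) := by nlinarith
            calc (f p / p) ^ 2 = f p ^ 2 / (p : ℝ) ^ 2 := div_pow _ _ _
              _ ≤ A ^ 2 / (p : ℝ) ^ 2 :=
                  div_le_div_of_nonneg_right (pow_le_pow_left₀ (hf0 p hpp) (hfA p hpp) 2)
                    (by positivity)
              _ ≤ A ^ 2 / ((p : ℝ) * (p - 1)) :=
                  div_le_div_of_nonneg_left (sq_nonneg A) hp1 (by nlinarith)
              _ = A ^ 2 * (1 / ((p : ℝ) * (p - 1))) := by rw [mul_one_div]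
      _ = A ^ 2 * ∑ p ∈ T, 1 / ((p : ℝ) * (p - 1)) := by rw [mul_sum]
      _ ≤ A ^ 2 * 1 :=
          mul_le_mul_of_nonneg_left (MertensBound.sum_inv_prime_mul_pred_le_one y) (sq_nonneg A)
      _ = A ^ 2 := mul_one _
  -- (3) the linear terms: `∑ f p/p ≥ a ∑ 1/p - K ∑ log p/p`
  have hlin : (a : ℝ) * (Real.log (Real.log y) - 24) - K * (Real.log y + Real.log 4) ≤
      ∑ p ∈ T, f p / p := by
    have hM2 := loglog_sub_le_sum_inv_primesLE hy
    have hM1 := MertensBound.sum_log_div_prime_le y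
    have h1 := mul_le_mul_of_nonneg_left hM2 ha0
    have h2 := mul_le_mul_of_nonneg_left hM1 hK
    have h3 : (a : ℝ) * (∑ p ∈ T, (p : ℝ)⁻¹) - K * (∑ p ∈ T, Real.log p / p) ≤
        ∑ p ∈ T, f p / p := by
      rw [mul_sum, mul_sum, ← sum_sub_distrib]
      refine sum_le_sum fun p hp => ?_
      have hpp := hmem p hp
      have hp0 : (0 : ℝ) < p := by exact_mod_cast hpp.pos
      have e : (a : ℝ) * (p : ℝ)⁻¹ - K * (Real.log p / p) = ((a : ℝ) - K * Real.log p) / p := by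
        ring
      rw [e]
      exact div_le_div_of_nonneg_right (hfa p hpp) hp0.le
    linarith
  -- (4) `log 4 ≤ 2 log y`
  have hlog4 : Real.log 4 ≤ 2 * Real.log y := by
    rw [show (4 : ℝ) = 2 ^ 2 by norm_num, Real.log_pow]
    push_cast
    linarith [Real.log_le_log two_pos hy']
  have hK4 : K * Real.log 4 ≤ 2 * (K * Real.log y) := by nlinarith
  -- (5) the logarithmic bound
  have hmain : (a : ℝ) * Real.log (Real.log y) - (24 * a + A ^ 2 + 3 * L) ≤
      Real.log (∏ p ∈ T, (1 + f p / p)) := by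
    have hsplit : ∑ p ∈ T, (f p / p - (f p / p) ^ 2) =
        ∑ p ∈ T, f p / p - ∑ p ∈ T, (f p / p) ^ 2 := sum_sub_distrib _ _
    linarith [hlog, hsq, hlin, hK4, hL, hsplit]
  -- (6) exponentiate
  calc Real.exp (-(24 * a + A ^ 2 + 3 * L)) * Real.log y ^ a
      = Real.exp ((a : ℝ) * Real.log (Real.log y) - (24 * a + A ^ 2 + 3 * L)) := by
        rw [Real.exp_sub, Real.exp_nat_mul, Real.exp_log hlogy, Real.exp_neg]
        ring
    _ ≤ Real.exp (Real.log (∏ p ∈ T, (1 + f p / p))) := Real.exp_le_exp.2 hmain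
    _ = ∏ p ∈ T, (1 + f p / p) := Real.exp_log hprodpos

/-- **The weighted powerset inequality.** For nonnegative weights `w, g` on a finite set `T`,
`∑_{S ⊆ T} (∏_{i∈S} w_i)(∑_{i∈S} g_i) ≤ (∑_{i∈T} g_i w_i) · ∏_{i∈T} (1 + w_i)`
(the exact value is `∑_i g_i w_i ∏_{j≠i} (1 + w_j)`; induction on `T`). [folklore] -/
theorem sum_powerset_prod_mul_sum_le {ι : Type*} [DecidableEq ι] (T : Finset ι) {w g : ι → ℝ}
    (hw : ∀ i ∈ T, 0 ≤ w i) (hg : ∀ i ∈ T, 0 ≤ g i) :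
    ∑ S ∈ T.powerset, (∏ i ∈ S, w i) * (∑ i ∈ S, g i) ≤
      (∑ i ∈ T, g i * w i) * ∏ i ∈ T, (1 + w i) := by
  induction T using Finset.induction_on with
  | empty => simp
  | insert a s ha ih =>
    have hwa := hw a (mem_insert_self a s)
    have hga := hg a (mem_insert_self a s)
    have hws : ∀ i ∈ s, 0 ≤ w i := fun i hi => hw i (mem_insert_of_mem hi)
    have hgs : ∀ i ∈ s, 0 ≤ g i := fun i hi => hg i (mem_insert_of_mem hi)
    have ih' := ih hws hgs
    have hP : ∑ t ∈ s.powerset, ∏ i ∈ t, w i = ∏ i ∈ s, (1 + w i) := (prod_one_add s).symm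
    have h2 : ∑ t ∈ s.powerset, (∏ i ∈ insert a t, w i) * (∑ i ∈ insert a t, g i) =
        w a * g a * (∏ i ∈ s, (1 + w i)) +
          w a * ∑ t ∈ s.powerset, (∏ i ∈ t, w i) * (∑ i ∈ t, g i) := by
      rw [← hP, mul_sum, mul_sum, ← sum_add_distrib]
      refine sum_congr rfl fun t ht => ?_
      have hat : a ∉ t := fun h => ha (mem_powerset.1 ht h)
      rw [prod_insert hat, sum_insert hat]
      ring
    rw [sum_powerset_insert ha, h2, sum_insert ha, prod_insert ha]
    set X := ∑ t ∈ s.powerset, (∏ i ∈ t, w i) * (∑ i ∈ t, g i)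
    set P := ∏ i ∈ s, (1 + w i)
    set G := ∑ i ∈ s, g i * w i
    have hP0 : 0 ≤ P := prod_nonneg fun i hi => by linarith [hws i hi]
    have h3 : w a * X ≤ w a * (G * P) := mul_le_mul_of_nonneg_left ih' hwa
    have h4 : 0 ≤ g a * w a * w a * P := mul_nonneg (mul_nonneg (mul_nonneg hga hwa) hwa) hP0
    nlinarith [ih', h3, h4]

/-- **The tail beyond `Y`, by logarithmic weighting.** With `0 ≤ f(p) ≤ A` at primes and
`Y ≥ 2`: `∑_{S ⊆ {p≤y}, ∏S > Y} ∏_{p∈S} f(p)/p ≤ [A(log y + log 4)/log Y] · ∏_{p≤y} (1 + f(p)/p)`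
(`1 ≤ log(∏S)/log Y` on the tail, `log ∏S = ∑_{p∈S} log p`, the weighted powerset inequality
and Mertens I from above). [folklore] -/
theorem sum_powerset_filter_prod_div_le {f : ℕ → ℝ} {A : ℝ} (hf0 : ∀ p : ℕ, p.Prime → 0 ≤ f p)
    (hfA : ∀ p : ℕ, p.Prime → f p ≤ A) (y : ℕ) {Y : ℕ} (hY : 2 ≤ Y) :
    ∑ S ∈ (Nat.primesLE y).powerset with ¬ (∏ p ∈ S, p ≤ Y), ∏ p ∈ S, f p / p ≤
      A * (Real.log y + Real.log 4) / Real.log Y * ∏ p ∈ Nat.primesLE y, (1 + f p / p) := by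
  set T := Nat.primesLE y with hT
  have hmem : ∀ p ∈ T, p.Prime := fun p hp => (Nat.mem_primesLE.1 hp).2
  have hsub : ∀ S ∈ T.powerset, ∀ p ∈ S, p.Prime := fun S hS p hp =>
    hmem p (mem_powerset.1 hS hp)
  have hY' : (2 : ℝ) ≤ Y := by exact_mod_cast hY
  have hlogY : 0 < Real.log Y := Real.log_pos (by linarith)
  have hA : 0 ≤ A := (hf0 2 Nat.prime_two).trans (hfA 2 Nat.prime_two)
  have hW0 : ∀ S ∈ T.powerset, 0 ≤ ∏ p ∈ S, f p / p := fun S hS =>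
    prod_nonneg fun p hp => div_nonneg (hf0 p (hsub S hS p hp)) (Nat.cast_nonneg p)
  have hlogS : ∀ S ∈ T.powerset, Real.log (∏ p ∈ S, (p : ℝ)) = ∑ p ∈ S, Real.log (p : ℝ) :=
    fun S hS => Real.log_prod fun p hp => (Nat.cast_pos.2 (hsub S hS p hp).pos).ne'
  have hlogS0 : ∀ S ∈ T.powerset, 0 ≤ ∑ p ∈ S, Real.log (p : ℝ) := fun S hS =>
    sum_nonneg fun p hp => Real.log_nonneg (by exact_mod_cast (hsub S hS p hp).one_lt.le)
  have hM0 : 0 ≤ ∏ p ∈ T, (1 + f p / p) := prod_nonneg fun p hp => by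
    linarith [div_nonneg (hf0 p (hmem p hp)) (Nat.cast_nonneg p)]
  -- steps 1–2: insert the factor `log(∏S)/log Y ≥ 1` on the tail, then drop the filter
  have h12 : ∑ S ∈ T.powerset with ¬ (∏ p ∈ S, p ≤ Y), ∏ p ∈ S, f p / p ≤
      ∑ S ∈ T.powerset, (∏ p ∈ S, f p / p) * ((∑ p ∈ S, Real.log (p : ℝ)) / Real.log Y) := by
    calc ∑ S ∈ T.powerset with ¬ (∏ p ∈ S, p ≤ Y), ∏ p ∈ S, f p / p
        ≤ ∑ S ∈ T.powerset with ¬ (∏ p ∈ S, p ≤ Y),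
            (∏ p ∈ S, f p / p) * ((∑ p ∈ S, Real.log (p : ℝ)) / Real.log Y) :=
          sum_le_sum fun S hS => by
            obtain ⟨hS, hlt⟩ := mem_filter.1 hS
            have hlt' : (Y : ℝ) ≤ ∏ p ∈ S, (p : ℝ) := by
              rw [← Nat.cast_prod]
              exact_mod_cast (not_le.1 hlt).le
            have h1 : 1 ≤ (∑ p ∈ S, Real.log (p : ℝ)) / Real.log Y := by
              rw [le_div_iff₀ hlogY, one_mul, ← hlogS S hS]
              exact Real.log_le_log (by linarith) hlt'
            have hW := hW0 S hS
            nlinarith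
      _ ≤ ∑ S ∈ T.powerset, (∏ p ∈ S, f p / p) * ((∑ p ∈ S, Real.log (p : ℝ)) / Real.log Y) :=
          sum_le_sum_of_subset_of_nonneg (filter_subset _ _) fun S hS _ =>
            mul_nonneg (hW0 S hS) (div_nonneg (hlogS0 S hS) hlogY.le)
  -- step 3: the weighted powerset inequality
  have h3 : ∑ S ∈ T.powerset, (∏ p ∈ S, f p / p) * (∑ p ∈ S, Real.log (p : ℝ)) ≤
      (∑ p ∈ T, Real.log (p : ℝ) * (f p / p)) * ∏ p ∈ T, (1 + f p / p) :=
    sum_powerset_prod_mul_sum_le T (fun p hp => div_nonneg (hf0 p (hmem p hp)) (Nat.cast_nonneg p))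
      (fun p hp => Real.log_nonneg (by exact_mod_cast (hmem p hp).one_lt.le))
  -- step 4: `∑_{p≤y} log p · f(p)/p ≤ A (log y + log 4)` (Mertens I from above)
  have h4 : ∑ p ∈ T, Real.log (p : ℝ) * (f p / p) ≤ A * (Real.log y + Real.log 4) := by
    calc ∑ p ∈ T, Real.log (p : ℝ) * (f p / p) ≤ ∑ p ∈ T, A * (Real.log p / p) :=
          sum_le_sum fun p hp => by
            have hpp := hmem p hp
            have hp0 : (0 : ℝ) < p := by exact_mod_cast hpp.pos
            have hl0 : 0 ≤ Real.log (p : ℝ) := Real.log_nonneg (by exact_mod_cast hpp.one_lt.le)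
            have e : Real.log (p : ℝ) * (f p / p) = (Real.log p / p) * f p := by ring
            rw [e, mul_comm A]
            exact mul_le_mul_of_nonneg_left (hfA p hpp) (div_nonneg hl0 hp0.le)
      _ = A * ∑ p ∈ T, Real.log p / p := by rw [mul_sum]
      _ ≤ A * (Real.log y + Real.log 4) :=
          mul_le_mul_of_nonneg_left (MertensBound.sum_log_div_prime_le y) hA
  -- assemble
  calc ∑ S ∈ T.powerset with ¬ (∏ p ∈ S, p ≤ Y), ∏ p ∈ S, f p / p
      ≤ ∑ S ∈ T.powerset, (∏ p ∈ S, f p / p) * ((∑ p ∈ S, Real.log (p : ℝ)) / Real.log Y) := h12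
    _ = (∑ S ∈ T.powerset, (∏ p ∈ S, f p / p) * (∑ p ∈ S, Real.log (p : ℝ))) / Real.log Y := by
        rw [sum_div]
        refine sum_congr rfl fun S _ => ?_
        ring
    _ ≤ ((∑ p ∈ T, Real.log (p : ℝ) * (f p / p)) * ∏ p ∈ T, (1 + f p / p)) / Real.log Y :=
        div_le_div_of_nonneg_right h3 hlogY.le
    _ ≤ (A * (Real.log y + Real.log 4) * ∏ p ∈ T, (1 + f p / p)) / Real.log Y :=
        div_le_div_of_nonneg_right (mul_le_mul_of_nonneg_right h4 hM0) hlogY.le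
    _ = A * (Real.log y + Real.log 4) / Real.log Y * ∏ p ∈ T, (1 + f p / p) := by ring

/-- **Half the product is carried by `∏S ≤ Y`.** With `0 ≤ f(p) ≤ A` at primes, `Y ≥ 2` and
`2A(log y + 2) ≤ log Y`:  `∏_{p≤y} (1 + f(p)/p) ≤ 2 ∑_{S ⊆ {p≤y}, ∏S ≤ Y} ∏_{p∈S} f(p)/p`
(the full sum over `S` is the product, Mathlib `Finset.prod_one_add`; the tail is at most half of it
since `log 4 < 2`). [folklore] -/
theorem prod_le_two_mul_sum_powerset_filter {f : ℕ → ℝ} {A : ℝ} (hf0 : ∀ p : ℕ, p.Prime → 0 ≤ f p)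
    (hfA : ∀ p : ℕ, p.Prime → f p ≤ A) {y Y : ℕ} (hY : 2 ≤ Y)
    (hyY : 2 * A * (Real.log y + 2) ≤ Real.log Y) :
    ∏ p ∈ Nat.primesLE y, (1 + f p / p) ≤
      2 * ∑ S ∈ (Nat.primesLE y).powerset with ∏ p ∈ S, p ≤ Y, ∏ p ∈ S, f p / p := by
  set T := Nat.primesLE y with hT
  have htot : (∑ S ∈ T.powerset with ∏ p ∈ S, p ≤ Y, ∏ p ∈ S, f p / p) +
      ∑ S ∈ T.powerset with ¬ (∏ p ∈ S, p ≤ Y), ∏ p ∈ S, f p / p =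
        ∏ p ∈ T, (1 + f p / p) := by
    rw [sum_filter_add_sum_filter_not, prod_one_add]
  have htail := sum_powerset_filter_prod_div_le hf0 hfA y hY
  have hY' : (2 : ℝ) ≤ Y := by exact_mod_cast hY
  have hlogY : 0 < Real.log Y := Real.log_pos (by linarith)
  have hA : 0 ≤ A := (hf0 2 Nat.prime_two).trans (hfA 2 Nat.prime_two)
  have hlog4 : Real.log 4 < 2 := by
    rw [show (4 : ℝ) = 2 ^ 2 by norm_num, Real.log_pow]
    push_cast
    linarith [Real.log_two_lt_d9]
  have hfrac : A * (Real.log y + Real.log 4) / Real.log Y ≤ 1 / 2 := by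
    rw [div_le_iff₀ hlogY]
    have : A * (Real.log y + Real.log 4) ≤ A * (Real.log y + 2) :=
      mul_le_mul_of_nonneg_left (by linarith) hA
    linarith
  have hM0 : 0 ≤ ∏ p ∈ T, (1 + f p / p) := prod_nonneg fun p hp => by
    linarith [div_nonneg (hf0 p (Nat.mem_primesLE.1 hp).2) (Nat.cast_nonneg p)]
  have hhalf := mul_le_mul_of_nonneg_right hfrac hM0
  linarith [htot, htail, hhalf]

/-! ### Part 3. From squarefree products of small primes to all `m ≤ Y` -/

/-- For a multiplicative `F`:
`∑_{S ⊆ {p ≤ y}, ∏S ≤ Y} ∏_{p∈S} |F(p)|²/p ≤ ∑_{1 ≤ m ≤ Y} |F(m)|²/m`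
(`S ↦ ∏S` is injective on sets of primes — Mathlib `Nat.primeFactors_prod` —,
`F(∏S) = ∏_{p∈S} F(p)` — `IsMultiplicative.map_prod_of_prime` —, and the other terms are `≥ 0`).
[folklore] -/
theorem sum_powerset_filter_le_sum_Icc {F : ArithmeticFunction ℂ} (hF : F.IsMultiplicative)
    (y Y : ℕ) :
    ∑ S ∈ (Nat.primesLE y).powerset with ∏ p ∈ S, p ≤ Y, ∏ p ∈ S, ‖F p‖ ^ 2 / p ≤
      ∑ m ∈ Icc 1 Y, ‖F m‖ ^ 2 / m := by
  set T := Nat.primesLE y with hT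
  set U := T.powerset.filter (fun S => ∏ p ∈ S, p ≤ Y) with hU
  have hprime : ∀ S ∈ U, ∀ p ∈ S, p.Prime := fun S hS p hp =>
    (Nat.mem_primesLE.1 (mem_powerset.1 (mem_filter.1 hS).1 hp)).2
  have hinj : Set.InjOn (fun S : Finset ℕ => ∏ p ∈ S, p) U := by
    intro S₁ h₁ S₂ h₂ heq
    have h := congrArg Nat.primeFactors heq
    simp only at h
    rwa [Nat.primeFactors_prod (hprime S₁ h₁), Nat.primeFactors_prod (hprime S₂ h₂)] at h
  have hterm : ∀ S ∈ U, ∏ p ∈ S, ‖F p‖ ^ 2 / p =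
      ‖F (∏ p ∈ S, p)‖ ^ 2 / ((∏ p ∈ S, p : ℕ) : ℝ) := fun S hS => by
    rw [hF.map_prod_of_prime S (hprime S hS), norm_prod, Nat.cast_prod, prod_div_distrib,
      prod_pow]
  calc ∑ S ∈ U, ∏ p ∈ S, ‖F p‖ ^ 2 / p
      = ∑ S ∈ U, ‖F (∏ p ∈ S, p)‖ ^ 2 / ((∏ p ∈ S, p : ℕ) : ℝ) := sum_congr rfl hterm
    _ = ∑ m ∈ U.image (fun S => ∏ p ∈ S, p), ‖F m‖ ^ 2 / (m : ℝ) := by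
        rw [sum_image hinj]
    _ ≤ ∑ m ∈ Icc 1 Y, ‖F m‖ ^ 2 / m := by
        refine sum_le_sum_of_subset_of_nonneg ?_ fun m _ _ => by positivity
        intro m hm
        obtain ⟨S, hS, rfl⟩ := mem_image.1 hm
        exact mem_Icc.2 ⟨Nat.one_le_iff_ne_zero.2
          (prod_ne_zero_iff.2 fun p hp => (hprime S hS p hp).ne_zero), (mem_filter.1 hS).2⟩

/-- **The engine.** Let `F : ArithmeticFunction ℂ` be multiplicative with
`a − K log p ≤ |F(p)|² ≤ A` at primes (`a : ℕ`, `K ≥ 0`). Then for `y ≥ 2`, `Y ≥ 2` with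
`2A(log y + 2) ≤ log Y` and `K log y ≤ L`:
`∑_{1 ≤ m ≤ Y} |F(m)|²/m ≥ ½ exp(−(24a + A² + 3L)) · (log y)^a`. [folklore] -/
theorem sum_norm_sq_div_ge {F : ArithmeticFunction ℂ} (hF : F.IsMultiplicative) {a : ℕ}
    {A K L : ℝ} (hK : 0 ≤ K) (hFA : ∀ p : ℕ, p.Prime → ‖F p‖ ^ 2 ≤ A)
    (hFa : ∀ p : ℕ, p.Prime → (a : ℝ) - K * Real.log p ≤ ‖F p‖ ^ 2) {y Y : ℕ} (hy : 2 ≤ y)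
    (hY : 2 ≤ Y) (hyY : 2 * A * (Real.log y + 2) ≤ Real.log Y) (hL : K * Real.log y ≤ L) :
    Real.exp (-(24 * a + A ^ 2 + 3 * L)) / 2 * Real.log y ^ a ≤
      ∑ m ∈ Icc 1 Y, ‖F m‖ ^ 2 / m := by
  have hf0 : ∀ p : ℕ, p.Prime → 0 ≤ ‖F p‖ ^ 2 := fun p _ => sq_nonneg _
  have h1 : Real.exp (-(24 * a + A ^ 2 + 3 * L)) * Real.log y ^ a ≤
      ∏ p ∈ Nat.primesLE y, (1 + ‖F p‖ ^ 2 / p) :=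
    exp_mul_log_pow_le_prod (f := fun p => ‖F p‖ ^ 2) hK hf0 hFA hFa hy hL
  have h2 : ∏ p ∈ Nat.primesLE y, (1 + ‖F p‖ ^ 2 / p) ≤
      2 * ∑ S ∈ (Nat.primesLE y).powerset with ∏ p ∈ S, p ≤ Y, ∏ p ∈ S, ‖F p‖ ^ 2 / p :=
    prod_le_two_mul_sum_powerset_filter (f := fun p => ‖F p‖ ^ 2) hf0 hFA hY hyY
  have h3 := sum_powerset_filter_le_sum_Icc hF y Y
  linarith

/-! ### Part 4. The instance: (7.5) from below on the class (7.2) -/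

/-- `F = n^{-β₁} ∗ n^{-β₂} ∗ n^{-β₃}` at a prime: `F(p) = p^{-ib₁} + p^{-ib₂} + p^{-ib₃}`.
[folklore] -/
theorem powI_mul_powI_mul_powI_apply_prime (b₁ b₂ b₃ : ℝ) {p : ℕ} (hp : p.Prime) :
    (powI b₁ * powI b₂ * powI b₃) p = powI b₁ p + powI b₂ p + powI b₃ p := by
  have h1 := isMultiplicative_powI b₁
  have h12 := h1.mul (isMultiplicative_powI b₂)
  rw [mul_apply_prime h12.map_one (isMultiplicative_powI b₃).map_one hp,
    mul_apply_prime h1.map_one (isMultiplicative_powI b₂).map_one hp]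

/-- `|F(p)|² ≤ 9` (three unimodular terms). [folklore] -/
theorem norm_sq_powI₃_prime_le (b₁ b₂ b₃ : ℝ) {p : ℕ} (hp : p.Prime) :
    ‖(powI b₁ * powI b₂ * powI b₃) p‖ ^ 2 ≤ 9 := by
  rw [powI_mul_powI_mul_powI_apply_prime b₁ b₂ b₃ hp]
  have h : ‖powI b₁ p + powI b₂ p + powI b₃ p‖ ≤ 3 := by
    calc ‖powI b₁ p + powI b₂ p + powI b₃ p‖ ≤ ‖powI b₁ p‖ + ‖powI b₂ p‖ + ‖powI b₃ p‖ :=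
          norm_add₃_le
      _ = 3 := by
          rw [norm_powI_of_pos b₁ hp.pos, norm_powI_of_pos b₂ hp.pos, norm_powI_of_pos b₃ hp.pos]
          norm_num
  nlinarith [norm_nonneg (powI b₁ p + powI b₂ p + powI b₃ p)]

/-- `|F(p)|² ≥ 9 − 6(|b₁|+|b₂|+|b₃|) log p`: `F(p) = 3 + ∑_j (p^{-ib_j} − 1)` with
`|p^{-ib_j} − 1| ≤ |b_j| log p` (`norm_powI_sub_one_le`), so `|F(p)| ≥ 3 − t` with
`t = (∑|b_j|) log p ≥ 0`, and `(3 − t)² ≥ 9 − 6t` (for `t > 3` the bound is negative). [folklore] -/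
theorem norm_sq_powI₃_prime_ge (b₁ b₂ b₃ : ℝ) {p : ℕ} (hp : p.Prime) :
    9 - 6 * ((|b₁| + |b₂| + |b₃|) * Real.log p) ≤ ‖(powI b₁ * powI b₂ * powI b₃) p‖ ^ 2 := by
  rw [powI_mul_powI_mul_powI_apply_prime b₁ b₂ b₃ hp]
  set r := (powI b₁ p - 1) + (powI b₂ p - 1) + (powI b₃ p - 1) with hr
  set t := (|b₁| + |b₂| + |b₃|) * Real.log p with ht
  have hl0 : 0 ≤ Real.log (p : ℝ) := Real.log_nonneg (by exact_mod_cast hp.one_lt.le)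
  have ht0 : 0 ≤ t := by positivity
  have hr_le : ‖r‖ ≤ t := by
    calc ‖r‖ ≤ ‖powI b₁ p - 1‖ + ‖powI b₂ p - 1‖ + ‖powI b₃ p - 1‖ := norm_add₃_le
      _ ≤ |b₁| * Real.log p + |b₂| * Real.log p + |b₃| * Real.log p := by
          gcongr
          · exact norm_powI_sub_one_le b₁ hp.pos
          · exact norm_powI_sub_one_le b₂ hp.pos
          · exact norm_powI_sub_one_le b₃ hp.pos
      _ = t := by rw [ht]; ring
  have he : powI b₁ p + powI b₂ p + powI b₃ p = 3 + r := by rw [hr]; ring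
  have hx : 3 - t ≤ ‖powI b₁ p + powI b₂ p + powI b₃ p‖ := by
    rw [he]
    have h3 : ‖(3 : ℂ)‖ = 3 := Complex.norm_ofNat 3
    have h := norm_sub_norm_le (3 : ℂ) (-r)
    rw [norm_neg, sub_neg_eq_add, h3] at h
    linarith
  set x := ‖powI b₁ p + powI b₂ p + powI b₃ p‖ with hxdef
  have hx0 : 0 ≤ x := norm_nonneg _
  rcases le_or_gt t 3 with h3 | h3
  · nlinarith [mul_nonneg (sub_nonneg.2 hx) (by linarith : 0 ≤ x + (3 - t))]
  · nlinarith [sq_nonneg x]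

/-- `κ ∗ 𝟙 = n^{-β₁} ∗ n^{-β₂} ∗ n^{-β₃}` (`μ ∗ 𝟙 = δ`). [folklore] -/
theorem kappa_mul_zeta (b₁ b₂ b₃ : ℝ) :
    kappa b₁ b₂ b₃ * (ArithmeticFunction.zeta : ArithmeticFunction ℂ) =
      powI b₁ * powI b₂ * powI b₃ := by
  rw [kappa, mul_assoc, coe_moebius_mul_coe_zeta, mul_one]

/-- For the constant sequence `a ≡ 1`: `(κ ∗ a)(m) = (κ ∗ 𝟙)(m) = F(m)`. [folklore] -/
theorem conv_kappa_one (b₁ b₂ b₃ : ℝ) (m : ℕ) :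
    conv (kappa b₁ b₂ b₃) (fun _ => 1) m = (powI b₁ * powI b₂ * powI b₃) m := by
  rw [← kappa_mul_zeta, coe_mul_zeta_apply, conv]
  calc ∑ x ∈ m.divisorsAntidiagonal, kappa b₁ b₂ b₃ x.1 * (fun _ => (1 : ℂ)) x.2
      = ∑ x ∈ m.divisorsAntidiagonal, kappa b₁ b₂ b₃ x.1 := sum_congr rfl fun x _ => mul_one _
    _ = ∑ d ∈ m.divisors, kappa b₁ b₂ b₃ d :=
        Nat.sum_divisorsAntidiagonal (fun i _ => kappa b₁ b₂ b₃ i)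

/-- **(7.5) from below, two-scale form.** For Zhang's `κ` (purely imaginary shifts `β_j = i b_j`)
and the bounded sequence `a ≡ 1` (`‖a‖_∞ = 1`, inside the class (7.2) `a₁(n) ≪ 1`): if `y ≥ 2`,
`18 (log y + 2) ≤ log Y` and `(|b₁|+|b₂|+|b₃|) log y ≤ L`, then
`∑_{1 ≤ m ≤ Y} |(κ∗1)(m)|²/m ≥ ½ e^{−(297 + 18L)} (log y)^9`.
The source's own count at this point is the UPPER bound `≪ ∑_{m<P²} τ₅(m)²/m` [p. 13]; nothing
about the manuscript's theorems is asserted. [cite: Zhang2022LandauSiegel, §7 (7.5) and (7.2) p. 13] -/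
theorem sum_norm_kappa_conv_one_sq_div_ge (b₁ b₂ b₃ : ℝ) {L : ℝ} {y Y : ℕ} (hy : 2 ≤ y)
    (hyY : 18 * (Real.log y + 2) ≤ Real.log Y) (hL : (|b₁| + |b₂| + |b₃|) * Real.log y ≤ L) :
    Real.exp (-(297 + 18 * L)) / 2 * Real.log y ^ 9 ≤
      ∑ m ∈ Icc 1 Y, ‖conv (kappa b₁ b₂ b₃) (fun _ => 1) m‖ ^ 2 / m := by
  have hmult : (powI b₁ * powI b₂ * powI b₃).IsMultiplicative :=
    ((isMultiplicative_powI b₁).mul (isMultiplicative_powI b₂)).mul (isMultiplicative_powI b₃)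
  have hy' : (2 : ℝ) ≤ y := by exact_mod_cast hy
  have hlogy : 0 < Real.log y := Real.log_pos (by linarith)
  have hlogY : 0 < Real.log Y := by linarith
  have hY : 2 ≤ Y := by
    by_contra h
    have h' := not_le.1 h
    interval_cases Y <;> simp at hlogY
  have hB : 0 ≤ |b₁| + |b₂| + |b₃| := by positivity
  have h := sum_norm_sq_div_ge hmult (a := 9) (A := 9) (K := 6 * (|b₁| + |b₂| + |b₃|))
    (L := 6 * L) (by positivity) (fun p hp => norm_sq_powI₃_prime_le b₁ b₂ b₃ hp)
    (fun (p : ℕ) hp => by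
      have := norm_sq_powI₃_prime_ge b₁ b₂ b₃ hp
      push_cast
      linarith) hy hY (by linarith) (by linarith)
  have hc : Real.exp (-(24 * ((9 : ℕ) : ℝ) + (9 : ℝ) ^ 2 + 3 * (6 * L))) =
      Real.exp (-(297 + 18 * L)) := by
    congr 1
    push_cast
    ring
  rw [hc] at h
  have e : ∀ m : ℕ, ‖conv (kappa b₁ b₂ b₃) (fun _ => 1) m‖ ^ 2 / (m : ℝ) =
      ‖(powI b₁ * powI b₂ * powI b₃) m‖ ^ 2 / (m : ℝ) := fun m => by rw [conv_kappa_one]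
  simp_rw [e]
  exact h

/-- **(7.5) from below, in `X` alone.** For Zhang's `κ` and `a ≡ 1`: if `log X ≥ 80` and
`(|b₁|+|b₂|+|b₃|) log X ≤ L` (in the source `X = P²` and `L = 12π(1 + 5c′α𝓛)` by (2.10), (2.13)),
then `∑_{1 ≤ m ≤ X} |(κ∗1)(m)|²/m ≥ e^{−(297+18L)}/(2·80⁹) · (log X)^9`
(the two-scale form at `y = ⌊X^{1/40}⌋`, where `log X/80 ≤ log y ≤ log X/40`).
[cite: Zhang2022LandauSiegel, §7 (7.5) and (7.2) p. 13, (2.10) p. 4, (2.13) p. 5] -/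
theorem sum_norm_kappa_conv_one_sq_div_ge_of_le_log (b₁ b₂ b₃ : ℝ) {L : ℝ} {Y : ℕ}
    (hY : 80 ≤ Real.log Y) (hL : (|b₁| + |b₂| + |b₃|) * Real.log Y ≤ L) :
    Real.exp (-(297 + 18 * L)) / (2 * 80 ^ 9) * Real.log Y ^ 9 ≤
      ∑ m ∈ Icc 1 Y, ‖conv (kappa b₁ b₂ b₃) (fun _ => 1) m‖ ^ 2 / m := by
  set r := Real.exp (Real.log Y / 40) with hr
  set y := ⌊r⌋₊ with hydef
  have hr0 : 0 < r := Real.exp_pos _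
  have hr2 : (2 : ℝ) ≤ r := by
    have h2 : Real.log 2 ≤ Real.log Y / 40 := by linarith [Real.log_two_lt_d9]
    calc (2 : ℝ) = Real.exp (Real.log 2) := (Real.exp_log two_pos).symm
      _ ≤ r := Real.exp_le_exp.2 h2
  have hy2 : 2 ≤ y := Nat.le_floor (by exact_mod_cast hr2)
  have hyr : (y : ℝ) ≤ r := Nat.floor_le hr0.le
  have hy0 : (0 : ℝ) < y := by exact_mod_cast (show 0 < y by omega)
  have hlogr : Real.log r = Real.log Y / 40 := by rw [hr, Real.log_exp]
  have hlogy_le : Real.log y ≤ Real.log Y / 40 := by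
    rw [← hlogr]
    exact Real.log_le_log hy0 hyr
  have hlogy_ge : Real.log Y / 80 ≤ Real.log y := by
    have h1 : r < y + 1 := Nat.lt_floor_add_one r
    have h2 : r / 2 ≤ y := by linarith
    calc Real.log Y / 80 ≤ Real.log Y / 40 - Real.log 2 := by linarith [Real.log_two_lt_d9]
      _ = Real.log (r / 2) := by rw [Real.log_div hr0.ne' two_ne_zero, hlogr]
      _ ≤ Real.log y := Real.log_le_log (by linarith) h2
  have hyY : 18 * (Real.log y + 2) ≤ Real.log Y := by linarith
  have hLy : (|b₁| + |b₂| + |b₃|) * Real.log y ≤ L := by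
    have hB : 0 ≤ |b₁| + |b₂| + |b₃| := by positivity
    have : (|b₁| + |b₂| + |b₃|) * Real.log y ≤ (|b₁| + |b₂| + |b₃|) * Real.log Y :=
      mul_le_mul_of_nonneg_left (by linarith) hB
    linarith
  have h := sum_norm_kappa_conv_one_sq_div_ge b₁ b₂ b₃ hy2 hyY hLy
  have hpow : (Real.log Y / 80) ^ 9 ≤ Real.log y ^ 9 :=
    pow_le_pow_left₀ (by linarith) hlogy_ge 9
  calc Real.exp (-(297 + 18 * L)) / (2 * 80 ^ 9) * Real.log Y ^ 9
      = Real.exp (-(297 + 18 * L)) / 2 * (Real.log Y / 80) ^ 9 := by ring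
    _ ≤ Real.exp (-(297 + 18 * L)) / 2 * Real.log y ^ 9 :=
        mul_le_mul_of_nonneg_left hpow (by positivity)
    _ ≤ _ := h

/-- **(7.5) is two-sided on the class (7.2).** For Zhang's `κ` (`β_j = i b_j`), `log X ≥ 80` and
`(|b₁|+|b₂|+|b₃|) log X ≤ L`:
(lower) the bounded sequence `a ≡ 1` has `∑_{m≤X} |(κ∗a)(m)|²/m ≥ e^{−(297+18L)}/(2·80⁹) (log X)^9`;
(upper, the companion's `sum_norm_kappa_conv_sq_div_le_of_mul_log_le` at `C = 1`) EVERY `a` with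
`‖a‖_∞ ≤ 1` has `∑_{m≤X} |(κ∗a)(m)|²/m ≤ majorantConst 9 8 · e^{32L} (log X)^9`.
So a majorant `‖a‖_∞² · O_L(1) · (log X)^k` on the class (7.2) holds with `k = 9` and with no
`k < 9`: the exponent `9` of `log P²` recorded by the cell at (7.5) is exact on that class (the
source prints `25`, from `τ₅²`). Nothing about the manuscript's theorems is asserted.
[cite: Zhang2022LandauSiegel, §7 (7.5) and (7.2) p. 13] -/
theorem sum_norm_kappa_conv_sq_div_two_sided (b₁ b₂ b₃ : ℝ) {L : ℝ} {Y : ℕ}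
    (hY : 80 ≤ Real.log Y) (hL : (|b₁| + |b₂| + |b₃|) * Real.log Y ≤ L) :
    Real.exp (-(297 + 18 * L)) / (2 * 80 ^ 9) * Real.log Y ^ 9 ≤
        ∑ m ∈ Icc 1 Y, ‖conv (kappa b₁ b₂ b₃) (fun _ => 1) m‖ ^ 2 / m ∧
      ∀ a : ℕ → ℂ, (∀ n, ‖a n‖ ≤ 1) →
        ∑ m ∈ Icc 1 Y, ‖conv (kappa b₁ b₂ b₃) a m‖ ^ 2 / m ≤
          majorantConst 9 8 * Real.exp (32 * L) * Real.log Y ^ 9 := by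
  refine ⟨sum_norm_kappa_conv_one_sq_div_ge_of_le_log b₁ b₂ b₃ hY hL, fun a ha => ?_⟩
  have hY4 : 4 ≤ Y := by
    by_contra h
    have hY3 : (Y : ℝ) ≤ 3 := by exact_mod_cast Nat.lt_succ_iff.1 (not_le.1 h)
    rcases Nat.eq_zero_or_pos Y with h0 | hpos
    · rw [h0, Nat.cast_zero, Real.log_zero] at hY
      linarith
    · have : Real.log Y ≤ Y - 1 := Real.log_le_sub_one_of_pos (by exact_mod_cast hpos)
      linarith
  have h := sum_norm_kappa_conv_sq_div_le_of_mul_log_le b₁ b₂ b₃ ha hY4 hL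
  simpa using h

end Literature.NumberTheory.LFunctions.Zhang2022.MeanSquareMajorant
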